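import Literature.Probability.LatticeModels.IsingModel
import Literature.Probability.LatticeModels.LeeYangFirstZeroLimit
import Literature.Probability.LatticeModels.LeeYangFirstZeroLimitProofs

/-!
# The first Lee–Yang zero of the free cube is positive and attained (stub `stub_firstZeroAttained`)

Route `LeeYangGap` (Ising3DConformalLimit), crux `NearCriticalLeeYangGap` (item stmt-CriticalPhenomena-4945),
line `registered`, stub S1a `stub_firstZeroAttained`. Nearest-neighbour Ising model on `ℤ³`, free cube
`Λ_L = box 3 L` (`|Λ_L| = (2L+1)³`), `M_Λ = ∑_{x ∈ Λ} σ_x`, Jiang–Newman's complex-field free-boundary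
partition function `Z_{Λ,β,h} = ∑_τ exp[β ∑_{uv} σ_uσ_v + h M_Λ]` (`JiangNewman.partitionFunction`) and the
modulus of its first zero `α₁(Λ,β) = JiangNewman.firstZero 3 Λ β = inf {t > 0 | Z_{Λ,β,it} = 0}`.

**Claim.** For every `L` and every `β ≥ 0`: `α₁(Λ_L, β) > 0` and
`⟨cos(α₁(Λ_L,β) · M_{Λ_L})⟩^free_{Λ_L;β,0} = 0`.

**Proof** (every ingredient is a tree theorem of `LeeYangFirstZeroLimitProofs`).
`JiangNewman.firstZero_spec`: for `β ≥ 0` and nonempty `Λ` the set `{t > 0 | Z_{Λ,β,it} = 0}` is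
non-empty (the finite trigonometric product `Z_{Λ,β,it} = Z_{Λ,β,0} cos(t)^a ∏_θ (1 - sin²t/sin²(θ/2))`
with `a + 2|S| = |Λ| ≥ 1` vanishes at `π/2` or at some `θ/2`), closed (continuity of `t ↦ Z_{Λ,β,it}`) and
bounded away from `0` (`Z_{Λ,β,0} > 0`), so its infimum `α₁` is positive and attained:
`Z_{Λ,β,iα₁} = 0`. Taking real parts, `Re Z_{Λ,β,it} = ∑_τ w(τ) cos(t M_Λ(τ))` with the zero-field
weights `w(τ) = exp(β ∑_e σ_e(τ))` (`JiangNewman.partitionFunction_mul_I_re`), while the zero-field free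
Gibbs average is `⟨f⟩^free_{Λ;β,0} = (∑_τ w(τ) f(τ)) / ∑_τ w(τ)` (`JiangNewman.isingExpect_zero_field_eq`);
hence `⟨cos(α₁ M_Λ)⟩^free_{Λ;β,0} = Re Z_{Λ,β,iα₁} / Z_{Λ,β,0} = 0`.

## References

* J. Jiang, C. M. Newman, *Thermodynamic limit of the first Lee–Yang zero*, CPAM 77 (2024)
  1224–1234, §1 eq. (1.3), §2 [JiangNewman2023].
* S. Friedli, Y. Velenik, Statistical Mechanics of Lattice Systems (CUP 2017), §3.1 eq. (3.8)
  [FriedliVelenik2017].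
-/

noncomputable section

namespace Summit.CriticalPhenomena.Ising3DConformalLimit.LeeYangGapNearCriticalLeeYangGap

open Literature.Probability.LatticeModels Finset Complex

/-- **S1a — the first Lee–Yang zero of the free cube is positive and is a zero of the block
characteristic function**: for every `L` and `β ≥ 0`, `α₁(Λ_L, β) > 0` and
`⟨cos(α₁(Λ_L,β) M_{Λ_L})⟩^free_{Λ_L;β,0} = 0`, where `Λ_L = box 3 L`, `M_Λ = ∑_{x ∈ Λ} σ_x` and
`α₁ = JiangNewman.firstZero` (the infimum of the positive zeros of `t ↦ Z_{Λ,β,it}` is attained,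
`JiangNewman.firstZero_spec`, and `Re Z_{Λ,β,it} = Z_{Λ,β,0} ⟨cos(t M_Λ)⟩^free_{Λ;β,0}`). -/
theorem stub_firstZeroAttained :
    ∀ (L : ℕ) (β : ℝ), 0 ≤ β →
      0 < Literature.Probability.LatticeModels.JiangNewman.firstZero 3
          (Literature.Probability.LatticeModels.box 3 L) β ∧
        Literature.Probability.LatticeModels.isingExpect (Literature.Probability.LatticeModels.zdGraph 3)
          (Literature.Probability.LatticeModels.box 3 L) β 0
          Literature.Probability.LatticeModels.BoundaryCondition.free
          (fun σ => Real.cos (Literature.Probability.LatticeModels.JiangNewman.firstZero 3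
            (Literature.Probability.LatticeModels.box 3 L) β *
            ∑ x ∈ Literature.Probability.LatticeModels.box 3 L,
              Literature.Probability.LatticeModels.spinAt x σ)) = 0 := by
  intro L β hβ
  obtain ⟨hpos, -, hZ⟩ := JiangNewman.firstZero_spec (d := 3) hβ (box_nonempty 3 L)
  refine ⟨hpos, ?_⟩
  -- the integrand is measurable (a continuous function of a finite sum of coordinate spins)
  have hmeas : Measurable fun σ : SpinConfig (Site 3) =>
      Real.cos (JiangNewman.firstZero 3 (box 3 L) β * ∑ x ∈ box 3 L, spinAt x σ) :=
    Real.measurable_cos.comp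
      ((Finset.measurable_sum _ fun x _ => measurable_spinAt x).const_mul _)
  -- real part of `Z_{Λ,β,iα₁} = 0` is the numerator of the zero-field average
  have hre := congrArg Complex.re hZ
  rw [JiangNewman.partitionFunction_mul_I_re, Complex.zero_re] at hre
  rw [JiangNewman.isingExpect_zero_field_eq (box 3 L) β hmeas, hre, zero_div]

end Summit.CriticalPhenomena.Ising3DConformalLimit.LeeYangGapNearCriticalLeeYangGap

end
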